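import Mathlib
import Literature.MathematicalPhysics.StatisticalMechanics.HaggStacking

/-!
# Route PricedLinkCensus — the per-period word excess of a periodic Hägg word
(`StackingHinge`, line Sketch; stub `stub_periodicWordExcess` of stmt-AtomisticToContinuum-14993)

The finite-volume Hägg domination WITH RATE (a hypothesis here, proved separately) says that for
every coupling `J : ℕ → ℝ` with `Σ_k k|J_k| < ∞`, every `±1` word `s` and every `n`,

  `n · Σ_{k ≥ 2 even} J_k + b_n · γ ≤ H_n(J, s) + Σ_k k|J_k|`,

with `γ = −J₂ − Σ_{k ≥ 3} (k−1)|J_k|`, `b_n = #{m < n : s (m+1) = s m}` the number of bad bonds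
(cubic layers) in `[0, n)` and `H_n(J, s) = haggEnergy n J s`.  For a `p`-PERIODIC word `s` we
derive the exact per-period statement, with no error term:

  `p · Σ_{k ≥ 2 even} J_k + b_p · γ ≤ H_p(J, s)`.

Proof.  Both `H_n` and `b_n` are additive over periods: `H_{pM} = M · H_p`
(`haggEnergy_mul_of_periodic`, from `haggLocalEnergy_periodic`) and `b_{pM} = M · b_p`
(`badBonds_mul_of_periodic`); both are instances of the elementary
`Σ_{m < pM} f m = M · Σ_{m < p} f m` for a `p`-periodic `f` (`sum_range_mul_of_periodic`).
Hence the hypothesis at `n = pM` reads `M · L ≤ M · H_p + T` with `L` the left-hand side above and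
the constant `T = Σ_k k|J_k|`; if `H_p < L`, an `M > T / (L − H_p)` (Archimedes) contradicts this.

All `[folklore]`.
-/

namespace Summit.AtomisticToContinuum.Crystallization.Theorems.PricedHcpWindowsWordExcess

open Finset Literature.MathematicalPhysics.StatisticalMechanics

/-- A sum of a `p`-periodic sequence over `M` consecutive periods is `M` times the sum over one
period: `Σ_{m < pM} f m = M · Σ_{m < p} f m`. [folklore] -/
theorem sum_range_mul_of_periodic {f : ℕ → ℝ} {p : ℕ} (hf : ∀ m, f (m + p) = f m) (M : ℕ) :
    ∑ m ∈ range (p * M), f m = (M : ℝ) * ∑ m ∈ range p, f m := by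
  induction M with
  | zero => simp
  | succ M ih =>
    rw [Nat.mul_succ, sum_range_add, ih, Nat.cast_succ, add_mul, one_mul]
    congr 1
    refine sum_congr rfl fun m _ => ?_
    have hper : Function.Periodic f p := hf
    rw [show p * M + m = m + M * p by ring]
    exact hper.nat_mul M m

/-- The finite-volume Hägg energy of a `p`-periodic word is additive over periods:
`H_{pM}(J, s) = M · H_p(J, s)`. [folklore] -/
theorem haggEnergy_mul_of_periodic {s : ℤ → ℤ} {p : ℕ} (hs : ∀ i, s (i + p) = s i) (J : ℕ → ℝ)
    (M : ℕ) : haggEnergy (p * M) J s = (M : ℝ) * haggEnergy p J s := by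
  unfold haggEnergy
  refine sum_range_mul_of_periodic (fun m => ?_) M
  push_cast
  exact haggLocalEnergy_periodic hs J m

/-- The number of bad bonds `#{m < n : s (m+1) = s m}` of a `p`-periodic word is additive over
periods: `b_{pM} = M · b_p` (stated with real casts). [folklore] -/
theorem badBonds_mul_of_periodic {s : ℤ → ℤ} {p : ℕ} (hs : ∀ i, s (i + p) = s i) (M : ℕ) :
    (((range (p * M)).filter (fun m : ℕ => s ((m : ℤ) + 1) = s m)).card : ℝ) =
      (M : ℝ) * (((range p).filter (fun m : ℕ => s ((m : ℤ) + 1) = s m)).card : ℝ) := by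
  rw [natCast_card_filter, natCast_card_filter]
  refine sum_range_mul_of_periodic (fun m => ?_) M
  have h1 : s (((m + p : ℕ) : ℤ) + 1) = s ((m : ℤ) + 1) := by
    push_cast
    rw [show (m : ℤ) + p + 1 = (m : ℤ) + 1 + p by ring, hs]
  have h2 : s ((m + p : ℕ) : ℤ) = s (m : ℤ) := by
    push_cast
    exact hs _
  rw [h1, h2]

/-- **Per-period word excess of a periodic Hägg word.**  Assuming the finite-volume Hägg
domination with rate `n · Σ_{k ≥ 2 even} J_k + b_n · γ ≤ H_n(J, s) + Σ_k k|J_k|`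
(`γ = −J₂ − Σ_{k ≥ 3}(k−1)|J_k|`, `b_n` the number of bad bonds `s (m+1) = s m`, `m < n`), every
`p`-periodic `±1` word `s` (`p ≠ 0`) with `Σ_k k|J_k| < ∞` satisfies the exact per-period bound
`p · Σ_{k ≥ 2 even} J_k + b_p · γ ≤ H_p(J, s) = haggEnergy p J s`. [folklore] -/
theorem stub_periodicWordExcess : (∀ (J : ℕ → ℝ) (s : ℤ → ℤ) (n : ℕ), (∀ i : ℤ, s i = 1 ∨ s i = -1) → Summable (fun k : ℕ => (k : ℝ) * |J k|) → (n : ℝ) * (∑' k : ℕ, (if 2 ≤ k ∧ Even k then J k else 0)) + (((Finset.range n).filter (fun m : ℕ => s ((m : ℤ) + 1) = s m)).card : ℝ) * (-J 2 - ∑' k : ℕ, (if 3 ≤ k then ((k : ℝ) - 1) * |J k| else 0)) ≤ Literature.MathematicalPhysics.StatisticalMechanics.haggEnergy n J s + ∑' k : ℕ, (k : ℝ) * |J k|) → ∀ (J : ℕ → ℝ) (s : ℤ → ℤ) (p : ℕ), p ≠ 0 → (∀ i : ℤ, s i = 1 ∨ s i = -1) → (∀ i : ℤ, s (i + p) = s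 i) → Summable (fun k : ℕ => (k : ℝ) * |J k|) → (p : ℝ) * (∑' k : ℕ, (if 2 ≤ k ∧ Even k then J k else 0)) + (((Finset.range p).filter (fun m : ℕ => s ((m : ℤ) + 1) = s m)).card : ℝ) * (-J 2 - ∑' k : ℕ, (if 3 ≤ k then ((k : ℝ) - 1) * |J k| else 0)) ≤ Literature.MathematicalPhysics.StatisticalMechanics.haggEnergy p J s := by
  intro hRate J s p _ hs hper hsum
  -- the hypothesis over `M` periods: `M · L ≤ M · H_p + T`
  have key : ∀ M : ℕ,
      (M : ℝ) * ((p : ℝ) * (∑' k : ℕ, (if 2 ≤ k ∧ Even k then J k else 0)) +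
        (((Finset.range p).filter (fun m : ℕ => s ((m : ℤ) + 1) = s m)).card : ℝ) *
          (-J 2 - ∑' k : ℕ, (if 3 ≤ k then ((k : ℝ) - 1) * |J k| else 0))) ≤
      (M : ℝ) * haggEnergy p J s + ∑' k : ℕ, (k : ℝ) * |J k| := by
    intro M
    have h := hRate J s (p * M) hs hsum
    rw [haggEnergy_mul_of_periodic hper J M, badBonds_mul_of_periodic hper M, Nat.cast_mul] at h
    linarith
  -- Archimedes: if `H_p < L`, some `M > T / (L - H_p)` violates `key M`
  refine not_lt.mp fun hlt => ?_
  set L := (p : ℝ) * (∑' k : ℕ, (if 2 ≤ k ∧ Even k then J k else 0)) +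
    (((Finset.range p).filter (fun m : ℕ => s ((m : ℤ) + 1) = s m)).card : ℝ) *
      (-J 2 - ∑' k : ℕ, (if 3 ≤ k then ((k : ℝ) - 1) * |J k| else 0))
  set H := haggEnergy p J s
  set T := ∑' k : ℕ, (k : ℝ) * |J k|
  have hε : 0 < L - H := sub_pos.2 hlt
  obtain ⟨M, hM⟩ := exists_nat_gt (T / (L - H))
  have h1 : T < (M : ℝ) * (L - H) := (div_lt_iff₀ hε).1 hM
  have h2 := key M
  linarith

end Summit.AtomisticToContinuum.Crystallization.Theorems.PricedHcpWindowsWordExcess
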